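import Summits.QuantumFields.YangMills.Theorems.BalabanUVNodesN12AtRecord13LiveLine
import Summits.QuantumFields.YangMills.Theorems.BalabanUVNodesN12LeafIntAtRecord13Chi
import Literature.MathematicalPhysics.QuantumFieldTheory.Balaban1983to89.Node00.Record13LiveSelectorChi

/-!
# BalabanUVNodes ∕ N12 — χ-GENERIC RE-ISSUE (RC-1 «RE-CENTRE THE RECORD», director-ym №462 (B) ∕ №467 (D)) of `…N12AtRecord13LiveLine` §3: AT THE χ-LIVE RE-PIN
# `Θ.liveRepin₁₃Chi χ` the fibre-witness display of the [IV] leaf at `WOfRecord₁₃Chi` is FREE and the mass display reads «every LIVE pre-𝐑 term has positive mass»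

Cell `pub-ymgap` (HUMAN RULING D-0062), seat `pub-ymgap-dag-n12-d` g36 (R134 N12 [B15] s2 «knit at the record»).  Sibling of `BalabanUVNodesN12AtRecord13LiveLine` (this seat).

WHY.  The route's K-cruxes read the RE-CENTRED record since rev 31∕32 ([Ax-2]∕[Ax-3]: `Node00/SmallFieldChi29AxOfRecord`, `Node00/Record13{Ax,Chi,CoPHChi,SepCoPHChi}` — the
Stage-13 chain re-issued GENERIC in the β-slot `χ : ChiSlot F N`; node00-def-Y's `Node00/Record13LiveSelectorChi` — the live re-pin `liveRepin₁₃Chi θ χ` and `Record13` §4c's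
rows in the χ slot).  This seat's kernel σ-closure of N12's junction of record (`N12-SIGMA-CLOSURE-Ax.g36.md`, evidence #2 on 27239; dag-lead g40 WORDS 584 ∕ HANDS-3 addendum:
«N12 road at the re-centred record = dag-n12-d's lane») lists the 13 N12-side statements that read the (2.9) centre, in 8 modules; THIS FILE is the sibling of ONE of them,
re-issuing its Record-13-keyed theorems VERBATIM under the token map σ = (`Θ.liveRepin₁₃ ↦ Θ.liveRepin₁₃Chi … χ`, `gOfRecord₁₃ ↦ gOfRecord₁₃Chi … χ`, `reprTOfRecord₁₃ ↦
reprTOfRecord₁₃Chi … χ`, `EOfRecord₁₃ ↦ EOfRecord₁₃Chi … χ`, `WOfRecord₁₃ ↦ WOfRecord₁₃Chi … χ`, `Provisos₁₃ ↦ Provisos₁₃Chi … χ`, `betaOfRecord₁₃ ↦ betaOfRecord₁₃Chi … χ`,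
`pinRPrime₁₃ ↦ pinRPrime₁₃Chi … χ`, `N0OfRecord₁₃ ↦ N0OfRecord₁₃Chi … χ`; K0a faces `↦ …Chi_…`), same short names in the sibling namespace (dag-n11-d's convention; consumers
switch by namespace).  dag-n11-e's three live-selector wrappers (`ppSel_succ_idem_of_liveSel`, `liveRepin₁₃_liveSel`, `rstep₁₃_of_liveSel_of_hasResiduals`) are NOT
restated: their one-line bodies over the history-generic NODE 00 lemmas (`ppSelLiveOfRecord_succ_idem`, `rfl`, `rstep₁₃_of_localBg_liveSel_chi`) are inlined.  At
`χ := chiβOfRecord₁₃ Θ` every theorem IS the parent's (definitionally, [Ax-3b]'s `rfl` receipts); at `χ := chiβOfRecord₁₃Ax Θ` it is what the re-centred record's N12 road reads.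
Nothing of record edited (body-freeze №460 (2)).

HONEST FRAMING.  Kernel bookkeeping BY NAME, χ-generic (definitions over the β-slot parameter + the parents' proofs verbatim); the displayed rows of the parent stay DISPLAYED;
nothing of Bałaban's asserted; N12 NOT discharged; K0ᴬ ∕ K1ᴬ ∕ K3ᴬ OPEN; counts unmoved; one finite 𝕋⁴ programme at fixed `ε = L^{-K}` — NOT continuum ∕ ℝ⁴ ∕ OS; NOT the
Yang–Mills mass gap (Clay).  THEOREMS ONLY (0 `def`, 0 `instance`, 0 `sorry`).  Filed `--kind proof --supports stmt-QuantumFields-27239 --as helper` (K1ᴬ, route rev 31∕32).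
Sources (bookkeeping only): [Balaban1989LargeFieldI] (0.2)–(0.6) pp.176–177, Prop. 1 (1.78) p.194, (1.80) p.195, (1.89) p.198, (1.99)–(1.102) pp.200–201;
[Balaban1988Convergent] (2.18) p.257, (3.22)–(3.25) pp.269–270; [Balaban1987RG1] (0.17)–(0.20) pp.255–256, (2.9) p.266 (the cut-off's centre).
-/

noncomputable section

open scoped BigOperators ENNReal
open MeasureTheory
open scoped Matrix.Norms.L2Operator

namespace Summit.QuantumFields.YangMills.BalabanUVNodes.N12AtRecord13LiveLineChi

open Literature.MathematicalPhysics.QuantumFieldTheory.Balaban1983to89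
open Literature.MathematicalPhysics.QuantumFieldTheory.Balaban1983to89.T4Continuum (T4Family)
open Literature.MathematicalPhysics.QuantumFieldTheory.Balaban1983to89.DagBinding
  (WorldP leavesP PrintedCarriersR PrintedCarriers15 B15Leaf B8LeafR B9LeafX B11Leaf Nodes)
open Literature.MathematicalPhysics.QuantumFieldTheory.Balaban1983to89.Node00
open FlowStep (BetaLowerH BetaUpperH)
open FlowStepRuns (genFlow)
open B15Claim189Assembly (new189 chiPP dom)
open B15 (Prop1Printed Ineq180)
open B15.BasicStep (Claim189 fibreIntegral)
open B8Eq17ClassAkV1 (plaqsOf)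
open B15LeafKnitMassSel (fibreWitness_of_idem)
open B15RPrime1100OfRep (rPrimeDataOfSel)
open B16RLeafRecord13Live (ppSel_succ_idem_of_liveSel laws₁₃_of_liveSel)
open Summit.QuantumFields.YangMills.BalabanUVNodes.N12AtRecord12LiveSelector (forall_mass_pos_ppSelLive_iff)
open Summit.QuantumFields.YangMills.BalabanUVNodes.N12LeafIntAtRecord13Chi
  (b15Leaf_WOfRecord₁₃_of_massSel b15Leaf_WOfRecord₁₃_of_provisosInt_massSel)

variable {N : ℕ} [NeZero N] {F : T4Family}

section RepinChi
variable (Θ : Stage13Params F N) (χ : ChiSlot F N)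

/-- The ₁₃ live re-pin's selector at a positive level is idempotent (shape `Z″″ = Z″`; dag-n11-e's `ppSel_succ_idem_of_liveSel` at K0a's clause `liveRepin₁₃_ppSel`, `rfl`).
[cite: Balaban1989LargeFieldI, (0.3) p.176 (bookkeeping)] -/
theorem ppSel_liveRepin₁₃_succ_idem (P : B12.RunParams) (k : ℕ)
    (s : SeqOfRecord F Θ.ν Θ.τ9.M (gOfRecord₁₃Chi F N (Θ.liveRepin₁₃Chi F N χ) χ P) P.K (k + 1)) :
    (Θ.liveRepin₁₃Chi F N χ).ppSel P (gOfRecord₁₃Chi F N (Θ.liveRepin₁₃Chi F N χ) χ P) (k + 1)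
        ((Θ.liveRepin₁₃Chi F N χ).ppSel P (gOfRecord₁₃Chi F N (Θ.liveRepin₁₃Chi F N χ) χ P) (k + 1) s)
      = (Θ.liveRepin₁₃Chi F N χ).ppSel P (gOfRecord₁₃Chi F N (Θ.liveRepin₁₃Chi F N χ) χ P) (k + 1) s :=
  by
  rw [Stage13Params.liveRepin₁₃Chi_ppSel]
  exact B16RLeafRecord12AtLive.ppSelLiveOfRecord_succ_idem Θ.ν Θ.τ9 (EOfRecord₁₃Chi F N Θ χ) (wOfRecord₉ F N Θ.toStage9Params) P
    (gOfRecord₁₃Chi F N (Θ.liveRepin₁₃Chi F N χ) χ P) k s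

variable (lam : ResidW F N)

/-- **AT THE ₁₃ LIVE RE-PIN N12's FIBRE-WITNESS DISPLAY IS FREE**: `hfib` follows from `hmassSel` (dag-n12-e's `fibreWitness_of_idem` at the idempotent live selector), every run, every step.
[cite: Balaban1989LargeFieldI, (0.3) p.176, p.176 ll.14–16 (bookkeeping)] -/
theorem fibreWitness_liveRepin₁₃_of_massSel (P : B12.RunParams)
    (hmassSel : ∀ s, 0 < ∫ V, rterm (reprTOfRecord₁₃Chi F N (Θ.liveRepin₁₃Chi F N χ) χ P (lam.kSel P))
        ((Θ.liveRepin₁₃Chi F N χ).ppSel P (gOfRecord₁₃Chi F N (Θ.liveRepin₁₃Chi F N χ) χ P) (lam.kSel P + 1) s) V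
          ∂(fieldMeasure (F.P P.K) (lam.kSel P + 1) (SU N))) :
    ∀ s, ∃ s', (Θ.liveRepin₁₃Chi F N χ).ppSel P (gOfRecord₁₃Chi F N (Θ.liveRepin₁₃Chi F N χ) χ P) (lam.kSel P + 1) s'
        = (Θ.liveRepin₁₃Chi F N χ).ppSel P (gOfRecord₁₃Chi F N (Θ.liveRepin₁₃Chi F N χ) χ P) (lam.kSel P + 1) s ∧
      0 < ∫ V, rterm (reprTOfRecord₁₃Chi F N (Θ.liveRepin₁₃Chi F N χ) χ P (lam.kSel P)) s' V ∂(fieldMeasure (F.P P.K) (lam.kSel P + 1) (SU N)) :=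
  fibreWitness_of_idem _ _ (ppSel_liveRepin₁₃_succ_idem Θ χ P (lam.kSel P)) hmassSel

/-- **BELOW THE TORUS, AT THE ₁₃ LIVE RE-PIN WITH ITS STAGE-13 PROVISOS, N12's MASS DISPLAY ⟺ «every LIVE pre-𝐑 term has positive mass»** (Int currency): a live sequence exists at
level `k+1 ≤ K` by K0a's `exists_liveSeq_ppSelLive_of_int` fed by `Provisos₁₃.tstep ∕ .rstep` AT THE RE-PIN (displayed — they read the selector; K0‴'s content there), so the live selector's
range IS the live set (this seat's g4 `forall_mass_pos_ppSelLive_iff`). [cite: Balaban1989LargeFieldI, (0.3) p.176, p.176 ll.14–16; Balaban1988Convergent, (3.22)–(3.25) pp.269–270] -/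
theorem massSel_liveRepin₁₃_iff (hP : (Θ.liveRepin₁₃Chi F N χ).Provisos₁₃Chi F N χ) (P : B12.RunParams) {k : ℕ} (hk : k < P.K) :
    (∀ s, 0 < ∫ V, rterm (reprTOfRecord₁₃Chi F N (Θ.liveRepin₁₃Chi F N χ) χ P k)
        ((Θ.liveRepin₁₃Chi F N χ).ppSel P (gOfRecord₁₃Chi F N (Θ.liveRepin₁₃Chi F N χ) χ P) (k + 1) s) V ∂(fieldMeasure (F.P P.K) (k + 1) (SU N))) ↔
      ∀ s, LiveSeq F N Θ.ν Θ.τ9 P (gOfRecord₁₃Chi F N (Θ.liveRepin₁₃Chi F N χ) χ P) (k + 1)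
          (slotsTOfRecord F N Θ.ν Θ.τ9 (EOfRecord₁₃Chi F N (Θ.liveRepin₁₃Chi F N χ) χ) (wOfRecord₉ F N (Θ.liveRepin₁₃Chi F N χ).toStage9Params)
            (Θ.liveRepin₁₃Chi F N χ).ppSel P (gOfRecord₁₃Chi F N (Θ.liveRepin₁₃Chi F N χ) χ P) (k + 1)) s →
        0 < ∫ V, rterm (reprTOfRecord₁₃Chi F N (Θ.liveRepin₁₃Chi F N χ) χ P k) s V ∂(fieldMeasure (F.P P.K) (k + 1) (SU N)) := by
  have hex := exists_liveSeq_ppSelLive_of_int F N Θ.ν Θ.τ9 (EOfRecord₁₃Chi F N Θ χ) (wOfRecord₉ F N Θ.toStage9Params) P (gOfRecord₁₃Chi F N Θ χ P)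
    (fun j hj => hP.tstep P j hj) (fun j _ hj => hP.rstep P j hj) k hk
  exact forall_mass_pos_ppSelLive_iff (EOfRecord₁₃Chi F N Θ χ) (wOfRecord₉ F N Θ.toStage9Params) P (gOfRecord₁₃Chi F N Θ χ P) k hex _ _

/-- **THE [IV] LEAF AT THE ₁₃ LIVE RE-PIN's BUNDLE OF RECORD, `kSel P < K` — `hfib` DROPPED** (module A's `b15Leaf_WOfRecord₁₃_of_massSel` at `Θ.liveRepin₁₃`, the fibre witness by
`fibreWitness_liveRepin₁₃_of_massSel`).  Displayed: `Provisos₁₃` at the re-pin, the (1.100) pin equation, the denominator masses, Prop. 1 (1.78), (1.80), (1.89).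
[cite: Balaban1989LargeFieldI, (0.2)–(0.6) p.176, p.176 ll.14–16, Prop. 1 (1.78) p.194, (1.80) p.195, (1.89) p.198, (1.99)–(1.102) pp.200–201] -/
theorem b15Leaf_WOfRecord₁₃_liveRepin₁₃_of_massSel (hP : (Θ.liveRepin₁₃Chi F N χ).Provisos₁₃Chi F N χ) {P : B12.RunParams} (hk : lam.kSel P < P.K)
    (hpin : lam.D1100 P
      = rPrimeDataOfSel (reprTOfRecord₁₃Chi F N (Θ.liveRepin₁₃Chi F N χ) χ P (lam.kSel P))
          ((Θ.liveRepin₁₃Chi F N χ).ppSel P (gOfRecord₁₃Chi F N (Θ.liveRepin₁₃Chi F N χ) χ P) (lam.kSel P + 1))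
          (fibOfSeq F (Θ.liveRepin₁₃Chi F N χ).ν (Θ.liveRepin₁₃Chi F N χ).τ9 P (gOfRecord₁₃Chi F N (Θ.liveRepin₁₃Chi F N χ) χ P) (lam.kSel P + 1)))
    (hmassSel : ∀ s, 0 < ∫ V, rterm (reprTOfRecord₁₃Chi F N (Θ.liveRepin₁₃Chi F N χ) χ P (lam.kSel P))
        ((Θ.liveRepin₁₃Chi F N χ).ppSel P (gOfRecord₁₃Chi F N (Θ.liveRepin₁₃Chi F N χ) χ P) (lam.kSel P + 1) s) V ∂(fieldMeasure (F.P P.K) (lam.kSel P + 1) (SU N)))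
    (hP1 : Prop1Printed (lam.LF P))
    (h180 : ∀ U, new189 (lam.D189 P) U → ∀ i, (lam.D189 P).h ≤ i → i ≤ (lam.D189 P).k → ∀ q ∈ plaqsOf (dom (lam.D189 P) i),
      Ineq180 ((lam.D189 P).dev0 U q) ((lam.D189 P).ε (lam.D189 P).k) (lam.D189 P).η (lam.D189 P).B₃ (lam.D189 P).B₅ (lam.D189 P).M (lam.D189 P).δ
        ((lam.D189 P).dist q) (lam.D189 P).O1)
    (h189 : Claim189 (new189 (lam.D189 P)) (chiPP (lam.D189 P))) : B15Leaf (WOfRecord₁₃Chi F N (Θ.liveRepin₁₃Chi F N χ) χ lam P) :=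
  b15Leaf_WOfRecord₁₃_of_massSel (Θ.liveRepin₁₃Chi F N χ) χ lam hP hk hpin hmassSel (fibreWitness_liveRepin₁₃_of_massSel Θ χ lam P hmassSel) hP1 h180 h189

/-- **… ANY RUN, from the Int provisos of the knit datum at the re-pin DISPLAYED** (the degenerate-run form; `hfib` dropped). [cite: Balaban1989LargeFieldI, (0.2)–(0.6) p.176, Prop. 1 (1.78) p.194, (1.80) p.195, (1.89) p.198, (1.99)–(1.102) pp.200–201] -/
theorem b15Leaf_WOfRecord₁₃_liveRepin₁₃_of_provisosInt_massSel {P : B12.RunParams}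
    (hint : (repDataOfSel (reprTOfRecord₁₃Chi F N (Θ.liveRepin₁₃Chi F N χ) χ P (lam.kSel P))
      ((Θ.liveRepin₁₃Chi F N χ).ppSel P (gOfRecord₁₃Chi F N (Θ.liveRepin₁₃Chi F N χ) χ P) (lam.kSel P + 1))
      (fibOfSeq F (Θ.liveRepin₁₃Chi F N χ).ν (Θ.liveRepin₁₃Chi F N χ).τ9 P (gOfRecord₁₃Chi F N (Θ.liveRepin₁₃Chi F N χ) χ P) (lam.kSel P + 1))).ProvisosInt)
    (hpin : lam.D1100 P
      = rPrimeDataOfSel (reprTOfRecord₁₃Chi F N (Θ.liveRepin₁₃Chi F N χ) χ P (lam.kSel P))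
          ((Θ.liveRepin₁₃Chi F N χ).ppSel P (gOfRecord₁₃Chi F N (Θ.liveRepin₁₃Chi F N χ) χ P) (lam.kSel P + 1))
          (fibOfSeq F (Θ.liveRepin₁₃Chi F N χ).ν (Θ.liveRepin₁₃Chi F N χ).τ9 P (gOfRecord₁₃Chi F N (Θ.liveRepin₁₃Chi F N χ) χ P) (lam.kSel P + 1)))
    (hmassSel : ∀ s, 0 < ∫ V, rterm (reprTOfRecord₁₃Chi F N (Θ.liveRepin₁₃Chi F N χ) χ P (lam.kSel P))
        ((Θ.liveRepin₁₃Chi F N χ).ppSel P (gOfRecord₁₃Chi F N (Θ.liveRepin₁₃Chi F N χ) χ P) (lam.kSel P + 1) s) V ∂(fieldMeasure (F.P P.K) (lam.kSel P + 1) (SU N)))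
    (hP1 : Prop1Printed (lam.LF P))
    (h180 : ∀ U, new189 (lam.D189 P) U → ∀ i, (lam.D189 P).h ≤ i → i ≤ (lam.D189 P).k → ∀ q ∈ plaqsOf (dom (lam.D189 P) i),
      Ineq180 ((lam.D189 P).dev0 U q) ((lam.D189 P).ε (lam.D189 P).k) (lam.D189 P).η (lam.D189 P).B₃ (lam.D189 P).B₅ (lam.D189 P).M (lam.D189 P).δ
        ((lam.D189 P).dist q) (lam.D189 P).O1)
    (h189 : Claim189 (new189 (lam.D189 P)) (chiPP (lam.D189 P))) : B15Leaf (WOfRecord₁₃Chi F N (Θ.liveRepin₁₃Chi F N χ) χ lam P) :=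
  b15Leaf_WOfRecord₁₃_of_provisosInt_massSel (Θ.liveRepin₁₃Chi F N χ) χ lam hint hpin hmassSel (fibreWitness_liveRepin₁₃_of_massSel Θ χ lam P hmassSel)
    hP1 h180 h189

/-- **★ THE [IV] LEAF AT THE ₁₃ LIVE RE-PIN's BUNDLE OF RECORD ON THE LIVE-MASS PROVISO** (`kSel P < K`): `Provisos₁₃` at the re-pin + the (1.100) pin equation + «every LIVE pre-𝐑 term at level
`kSel P + 1` has positive mass» + EXACTLY Proposition 1 (1.78), (1.80), (1.89) — NO `hfib`, NO selector-keyed mass display. [cite: Balaban1989LargeFieldI, (0.2)–(0.6) p.176, p.176 ll.14–16, Prop. 1 (1.78) p.194, (1.80) p.195, (1.89) p.198, (1.99)–(1.102) pp.200–201; Balaban1988Convergent, (3.22)–(3.25) pp.269–270] -/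
theorem b15Leaf_WOfRecord₁₃_liveRepin₁₃_of_massLive (hP : (Θ.liveRepin₁₃Chi F N χ).Provisos₁₃Chi F N χ) {P : B12.RunParams} (hk : lam.kSel P < P.K)
    (hpin : lam.D1100 P
      = rPrimeDataOfSel (reprTOfRecord₁₃Chi F N (Θ.liveRepin₁₃Chi F N χ) χ P (lam.kSel P))
          ((Θ.liveRepin₁₃Chi F N χ).ppSel P (gOfRecord₁₃Chi F N (Θ.liveRepin₁₃Chi F N χ) χ P) (lam.kSel P + 1))
          (fibOfSeq F (Θ.liveRepin₁₃Chi F N χ).ν (Θ.liveRepin₁₃Chi F N χ).τ9 P (gOfRecord₁₃Chi F N (Θ.liveRepin₁₃Chi F N χ) χ P) (lam.kSel P + 1)))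
    (hmassLive : ∀ s, LiveSeq F N Θ.ν Θ.τ9 P (gOfRecord₁₃Chi F N (Θ.liveRepin₁₃Chi F N χ) χ P) (lam.kSel P + 1)
        (slotsTOfRecord F N Θ.ν Θ.τ9 (EOfRecord₁₃Chi F N (Θ.liveRepin₁₃Chi F N χ) χ) (wOfRecord₉ F N (Θ.liveRepin₁₃Chi F N χ).toStage9Params)
          (Θ.liveRepin₁₃Chi F N χ).ppSel P (gOfRecord₁₃Chi F N (Θ.liveRepin₁₃Chi F N χ) χ P) (lam.kSel P + 1)) s →
      0 < ∫ V, rterm (reprTOfRecord₁₃Chi F N (Θ.liveRepin₁₃Chi F N χ) χ P (lam.kSel P)) s V ∂(fieldMeasure (F.P P.K) (lam.kSel P + 1) (SU N)))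
    (hP1 : Prop1Printed (lam.LF P))
    (h180 : ∀ U, new189 (lam.D189 P) U → ∀ i, (lam.D189 P).h ≤ i → i ≤ (lam.D189 P).k → ∀ q ∈ plaqsOf (dom (lam.D189 P) i),
      Ineq180 ((lam.D189 P).dev0 U q) ((lam.D189 P).ε (lam.D189 P).k) (lam.D189 P).η (lam.D189 P).B₃ (lam.D189 P).B₅ (lam.D189 P).M (lam.D189 P).δ
        ((lam.D189 P).dist q) (lam.D189 P).O1)
    (h189 : Claim189 (new189 (lam.D189 P)) (chiPP (lam.D189 P))) : B15Leaf (WOfRecord₁₃Chi F N (Θ.liveRepin₁₃Chi F N χ) χ lam P) :=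
  b15Leaf_WOfRecord₁₃_liveRepin₁₃_of_massSel Θ χ lam hP hk hpin ((massSel_liveRepin₁₃_iff Θ χ hP P hk).2 hmassLive) hP1 h180 h189

/-- **N12's ROW FOR A WHOLE TOWER OF RUNS, run by run**: below the torus (`kSel P < K`) the live-mass form, on the other runs (`K ≤ kSel P`, where the record displays no tower clause) the
leaf handed as is. [cite: Balaban1989LargeFieldI, (0.2)–(0.6) p.176, Prop. 1 (1.78) p.194, (1.80) p.195, (1.89) p.198, (1.99)–(1.102) pp.200–201 (bookkeeping)] -/
theorem b15Leaf_WOfRecord₁₃_liveRepin₁₃_all_of_massLive (hP : (Θ.liveRepin₁₃Chi F N χ).Provisos₁₃Chi F N χ)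
    (hdeg : ∀ P : B12.RunParams, P.K ≤ lam.kSel P → B15Leaf (WOfRecord₁₃Chi F N (Θ.liveRepin₁₃Chi F N χ) χ lam P))
    (hpin : ∀ P : B12.RunParams, lam.kSel P < P.K → lam.D1100 P
      = rPrimeDataOfSel (reprTOfRecord₁₃Chi F N (Θ.liveRepin₁₃Chi F N χ) χ P (lam.kSel P))
          ((Θ.liveRepin₁₃Chi F N χ).ppSel P (gOfRecord₁₃Chi F N (Θ.liveRepin₁₃Chi F N χ) χ P) (lam.kSel P + 1))
          (fibOfSeq F (Θ.liveRepin₁₃Chi F N χ).ν (Θ.liveRepin₁₃Chi F N χ).τ9 P (gOfRecord₁₃Chi F N (Θ.liveRepin₁₃Chi F N χ) χ P) (lam.kSel P + 1)))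
    (hmassLive : ∀ P : B12.RunParams, lam.kSel P < P.K → ∀ s, LiveSeq F N Θ.ν Θ.τ9 P (gOfRecord₁₃Chi F N (Θ.liveRepin₁₃Chi F N χ) χ P) (lam.kSel P + 1)
        (slotsTOfRecord F N Θ.ν Θ.τ9 (EOfRecord₁₃Chi F N (Θ.liveRepin₁₃Chi F N χ) χ) (wOfRecord₉ F N (Θ.liveRepin₁₃Chi F N χ).toStage9Params)
          (Θ.liveRepin₁₃Chi F N χ).ppSel P (gOfRecord₁₃Chi F N (Θ.liveRepin₁₃Chi F N χ) χ P) (lam.kSel P + 1)) s →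
      0 < ∫ V, rterm (reprTOfRecord₁₃Chi F N (Θ.liveRepin₁₃Chi F N χ) χ P (lam.kSel P)) s V ∂(fieldMeasure (F.P P.K) (lam.kSel P + 1) (SU N)))
    (hP1 : ∀ P : B12.RunParams, lam.kSel P < P.K → Prop1Printed (lam.LF P))
    (h180 : ∀ P : B12.RunParams, lam.kSel P < P.K → ∀ U, new189 (lam.D189 P) U → ∀ i, (lam.D189 P).h ≤ i → i ≤ (lam.D189 P).k →
      ∀ q ∈ plaqsOf (dom (lam.D189 P) i),
        Ineq180 ((lam.D189 P).dev0 U q) ((lam.D189 P).ε (lam.D189 P).k) (lam.D189 P).η (lam.D189 P).B₃ (lam.D189 P).B₅ (lam.D189 P).M (lam.D189 P).δ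
          ((lam.D189 P).dist q) (lam.D189 P).O1)
    (h189 : ∀ P : B12.RunParams, lam.kSel P < P.K → Claim189 (new189 (lam.D189 P)) (chiPP (lam.D189 P))) :
    ∀ P : B12.RunParams, B15Leaf (WOfRecord₁₃Chi F N (Θ.liveRepin₁₃Chi F N χ) χ lam P) := fun P => by
  by_cases hk : lam.kSel P < P.K
  · exact b15Leaf_WOfRecord₁₃_liveRepin₁₃_of_massLive Θ χ lam hP hk (hpin P hk) (hmassLive P hk) (hP1 P hk) (h180 P hk) (h189 P hk)
  · exact hdeg P (not_lt.1 hk)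

end RepinChi

end Summit.QuantumFields.YangMills.BalabanUVNodes.N12AtRecord13LiveLineChi

end
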